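import Summits.HubbardSuperconductivity.HubbardSuperconductivity.Theorems.AnisotropyChordTransferFibre3Shell

/-!
# Route `AnisotropyChord` / H0 rotor rung: PORT N30-A revised targets — `TwoMagnonFourier` PROVED (`L ≥ 3`)

§285(c) of memo ROTOR-THEORY-20 (theory seat `hubbard-h0-rotor-theory-1`, cycle 20): the lattice Fourier transform of the
`K = 0` two-magnon equation.  If `f 0 = 0`, `f` takes the common value `f(x̂)` on the four nearest neighbours and solves
`Σ_e (f(r) − f(r+e)) − Δ·1_{NN}(r) f(r) = λ₂ f(r)` for `r ≠ 0`, then for every momentum `k`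
`(2ε(k) − λ₂) f̂(k) = −f(x̂)(4(1−Δ) + 2Δε(k))` — **`twoMagnonFourier_holds (hL : 3 ≤ L) : TwoMagnonFourier L Δ lam2`**.
(`L ≥ 3` is needed: at `L = 2` the neighbour list `[(1,0),(−1,0),(0,1),(0,−1)]` has repeated entries while the indicator
`1_{NN}` has not, and the identity fails for `Δ ≠ 0`.)
Proof: transform the defect `g(r) = [equation](r)`, supported at `r = 0` with `g(0) = −4f(x̂)`; the hopping part transforms to
`2ε(k)f̂(k)` (shift `Σ_r φ̄_k(r) f(r+e) = φ_k(e) f̂(k)` and `Σ_e φ_k(e) = 4 − 2ε(k)`, `sum_phase_nn`), the contact part to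
`f(x̂)(4 − 2ε(k))`.  Prover seat `hubbard-h0-rotor-p1` g21; helper for stmt-HubbardSuperconductivity-19089 (`--supports`).
-/

set_option linter.dupNamespace false
set_option autoImplicit false

noncomputable section

open scoped BigOperators
open Complex

namespace Summit.HubbardSuperconductivity.HubbardSuperconductivity.Theorems.AnisotropyChord.Transfer.Fibre3

variable (L : ℕ) [NeZero L]

omit [NeZero L] in
/-- [folklore] -/
theorem isNN_ex : IsNN L (ex L) = true := by unfold IsNN ex; simp

omit [NeZero L] in
/-- [folklore] -/
theorem isNN_ey : IsNN L (ey L) = true := by unfold IsNN ey; simp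

/-- **shift rule:** `Σ_r conj(φ_k(r)) f(r+e) = φ_k(e) f̂(k)`. [folklore] -/
theorem dft_shift (f : Tor L → ℝ) (k e : Tor L) :
    ∑ r : Tor L, (starRingEnd ℂ) (phase L k r) * (f (r + e) : ℂ) = phase L k e * dft L f k := by
  unfold dft
  rw [Finset.mul_sum]
  refine Fintype.sum_equiv (Equiv.addRight e) _ _ fun r => ?_
  simp only [Equiv.coe_addRight]
  rw [phase_add, map_mul, conj_phase L k e]
  rw [show phase L k e * ((starRingEnd ℂ) (phase L k r) * phase L k (-e) * ((f (r + e) : ℝ) : ℂ))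
      = (phase L k e * phase L k (-e)) * ((starRingEnd ℂ) (phase L k r) * ((f (r + e) : ℝ) : ℂ)) by ring,
    phase_mul_neg, one_mul]

omit [NeZero L] in
/-- for `L ≥ 3` the four nearest-neighbour vectors are pairwise distinct. [folklore] -/
theorem nn_distinct (hL : 3 ≤ L) :
    ex L ≠ -ex L ∧ ex L ≠ ey L ∧ ex L ≠ -ey L ∧ -ex L ≠ ey L ∧ -ex L ≠ -ey L ∧ ey L ≠ -ey L := by
  have one_ne : (1 : ZMod L) ≠ 0 := by
    intro h
    have h' : ((1 : ℕ) : ZMod L) = 0 := by exact_mod_cast h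
    rw [ZMod.natCast_eq_zero_iff] at h'
    have := Nat.le_of_dvd Nat.one_pos h'
    omega
  have two_ne : (2 : ZMod L) ≠ 0 := by
    intro h
    have h' : ((2 : ℕ) : ZMod L) = 0 := by exact_mod_cast h
    rw [ZMod.natCast_eq_zero_iff] at h'
    have := Nat.le_of_dvd (by norm_num) h'
    omega
  have negone_ne : (-1 : ZMod L) ≠ 0 := neg_ne_zero.mpr one_ne
  have one_ne_neg : (1 : ZMod L) ≠ -1 := by
    intro h; apply two_ne; linear_combination h
  refine ⟨?_, ?_, ?_, ?_, ?_, ?_⟩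
  · intro h; have := congrArg Prod.fst h; simp only [ex, Prod.neg_mk] at this; exact one_ne_neg this
  · intro h; have := congrArg Prod.fst h; simp only [ex, ey] at this; exact one_ne this
  · intro h; have := congrArg Prod.fst h; simp only [ex, ey, Prod.neg_mk, neg_zero] at this; exact one_ne this
  · intro h; have := congrArg Prod.fst h; simp only [ex, ey, Prod.neg_mk] at this; exact negone_ne this
  · intro h; have := congrArg Prod.fst h; simp only [ex, ey, Prod.neg_mk, neg_zero] at this; exact negone_ne this
  · intro h; have := congrArg Prod.snd h; simp only [ey, Prod.neg_mk] at this; exact one_ne_neg this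

/-- the set of nearest-neighbour vectors. [folklore] -/
theorem filter_isNN :
    Finset.univ.filter (fun r : Tor L => IsNN L r = true) = {ex L, -ex L, ey L, -ey L} := by
  ext r
  simp only [Finset.mem_filter, Finset.mem_univ, true_and, Finset.mem_insert, Finset.mem_singleton]
  constructor
  · exact eq_of_isNN L
  · rintro (rfl | rfl | rfl | rfl)
    · exact isNN_ex L
    · rw [IsNN_neg]; exact isNN_ex L
    · exact isNN_ey L
    · rw [IsNN_neg]; exact isNN_ey L

/-- **`TwoMagnonFourier` holds** for `L ≥ 3`. [folklore] -/
theorem twoMagnonFourier_holds (hL : 3 ≤ L) (Δ lam2 : ℝ) : TwoMagnonFourier L Δ lam2 := by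
  intro f hf0 hnn heq k
  have exl : (((1 : ZMod L), (0 : ZMod L)) : Tor L) = ex L := rfl
  have eyl : (((0 : ZMod L), (1 : ZMod L)) : Tor L) = ey L := rfl
  -- values on the four neighbours
  have f1 : f (ex L) = f (K1 L) := hnn _ (by unfold nnList ex; simp)
  have f2 : f (-ex L) = f (K1 L) := hnn _ (by rw [← neg_ex]; unfold nnList; simp)
  have f3 : f (ey L) = f (K1 L) := hnn _ (by unfold nnList ey; simp)
  have f4 : f (-ey L) = f (K1 L) := hnn _ (by rw [← neg_ey]; unfold nnList; simp)
  -- the neighbour sum, explicitly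
  have hlist : ∀ r : Tor L, ((nnList L).map (fun e => f r - f (r + e))).sum
      = (f r - f (r + ex L)) + ((f r - f (r + -ex L)) + ((f r - f (r + ey L)) + (f r - f (r + -ey L)))) := by
    intro r
    simp only [nnList, List.map_cons, List.map_nil, List.sum_cons, List.sum_nil, add_zero, neg_ex, neg_ey, exl, eyl]
  -- the defect of the equation: zero off the origin, `−4 f(x̂)` at the origin
  have hzero : ∀ r : Tor L, r ≠ 0 →
      ((nnList L).map (fun e => f r - f (r + e))).sum - Δ * (if IsNN L r then 1 else 0) * f r - lam2 * f r = 0 := by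
    intro r hr; have := heq r hr; linarith
  have h0val : ((nnList L).map (fun e => f 0 - f (0 + e))).sum - Δ * (if IsNN L 0 then 1 else 0) * f 0 - lam2 * f 0
      = -4 * f (K1 L) := by
    rw [hlist, hf0]; simp only [zero_add, zero_sub, f1, f2, f3, f4]; ring
  -- (i) Fourier transform of the defect
  have hS1 : ∑ r : Tor L, (starRingEnd ℂ) (phase L k r) *
      ((((nnList L).map (fun e => f r - f (r + e))).sum - Δ * (if IsNN L r then 1 else 0) * f r - lam2 * f r : ℝ) : ℂ)
      = -4 * (f (K1 L) : ℂ) := by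
    rw [Finset.sum_eq_single (0 : Tor L)]
    · rw [h0val, phase_zero, map_one, one_mul]; push_cast; ring
    · intro r _ hr; rw [hzero r hr]; simp
    · intro h; exact absurd (Finset.mem_univ _) h
  -- (ii) the hopping part transforms to `2ε(k) f̂(k)`
  have hhop : ∑ r : Tor L, (starRingEnd ℂ) (phase L k r) * ((((nnList L).map (fun e => f r - f (r + e))).sum : ℝ) : ℂ)
      = ((2 * epsT L k : ℝ) : ℂ) * dft L f k := by
    have hr : ∀ r : Tor L, (starRingEnd ℂ) (phase L k r) * ((((nnList L).map (fun e => f r - f (r + e))).sum : ℝ) : ℂ)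
        = 4 * ((starRingEnd ℂ) (phase L k r) * (f r : ℂ))
          - ((starRingEnd ℂ) (phase L k r) * (f (r + ex L) : ℂ) + (starRingEnd ℂ) (phase L k r) * (f (r + -ex L) : ℂ)
            + (starRingEnd ℂ) (phase L k r) * (f (r + ey L) : ℂ) + (starRingEnd ℂ) (phase L k r) * (f (r + -ey L) : ℂ)) := by
      intro r; rw [hlist]; push_cast; ring
    rw [Finset.sum_congr rfl fun r _ => hr r, Finset.sum_sub_distrib, ← Finset.mul_sum, Finset.sum_add_distrib,
      Finset.sum_add_distrib, Finset.sum_add_distrib, dft_shift, dft_shift, dft_shift, dft_shift]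
    have hsp := sum_phase_nn L k
    unfold dft
    rw [show 4 * ∑ r : Tor L, (starRingEnd ℂ) (phase L k r) * (f r : ℂ)
        - (phase L k (ex L) * ∑ r : Tor L, (starRingEnd ℂ) (phase L k r) * (f r : ℂ)
          + phase L k (-ex L) * ∑ r : Tor L, (starRingEnd ℂ) (phase L k r) * (f r : ℂ)
          + phase L k (ey L) * ∑ r : Tor L, (starRingEnd ℂ) (phase L k r) * (f r : ℂ)
          + phase L k (-ey L) * ∑ r : Tor L, (starRingEnd ℂ) (phase L k r) * (f r : ℂ))
        = (4 - (phase L k (ex L) + phase L k (-ex L) + phase L k (ey L) + phase L k (-ey L)))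
          * ∑ r : Tor L, (starRingEnd ℂ) (phase L k r) * (f r : ℂ) by ring, hsp]
    push_cast; ring
  -- (iii) the contact part transforms to `f(x̂)(4 − 2ε(k))`
  have hconj : (starRingEnd ℂ) (phase L k (ex L)) + (starRingEnd ℂ) (phase L k (-ex L))
      + (starRingEnd ℂ) (phase L k (ey L)) + (starRingEnd ℂ) (phase L k (-ey L)) = ((4 - 2 * epsT L k : ℝ) : ℂ) := by
    rw [← map_add, ← map_add, ← map_add, sum_phase_nn, Complex.conj_ofReal]
  obtain ⟨d1, d2, d3, d4, d5, d6⟩ := nn_distinct L hL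
  have hcont : ∑ r : Tor L, (starRingEnd ℂ) (phase L k r) * (((Δ * (if IsNN L r then 1 else 0) * f r : ℝ)) : ℂ)
      = (Δ : ℂ) * (f (K1 L) : ℂ) * ((4 - 2 * epsT L k : ℝ) : ℂ) := by
    have hr : ∀ r : Tor L, (starRingEnd ℂ) (phase L k r) * (((Δ * (if IsNN L r then 1 else 0) * f r : ℝ)) : ℂ)
        = if IsNN L r = true then (Δ : ℂ) * ((starRingEnd ℂ) (phase L k r) * (f r : ℂ)) else 0 := by
      intro r; split_ifs <;> push_cast <;> ring
    rw [Finset.sum_congr rfl fun r _ => hr r, ← Finset.sum_filter, filter_isNN, ← Finset.mul_sum,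
      Finset.sum_insert (by simp only [Finset.mem_insert, Finset.mem_singleton, not_or]; exact ⟨d1, d2, d3⟩),
      Finset.sum_insert (by simp only [Finset.mem_insert, Finset.mem_singleton, not_or]; exact ⟨d4, d5⟩),
      Finset.sum_insert (by simp only [Finset.mem_singleton]; exact d6), Finset.sum_singleton,
      f1, f2, f3, f4, ← hconj]
    ring
  -- (iv) assemble
  have hsplit : ∀ r : Tor L, (starRingEnd ℂ) (phase L k r) *
      ((((nnList L).map (fun e => f r - f (r + e))).sum - Δ * (if IsNN L r then 1 else 0) * f r - lam2 * f r : ℝ) : ℂ)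
      = (starRingEnd ℂ) (phase L k r) * ((((nnList L).map (fun e => f r - f (r + e))).sum : ℝ) : ℂ)
        - (starRingEnd ℂ) (phase L k r) * (((Δ * (if IsNN L r then 1 else 0) * f r : ℝ)) : ℂ)
        - (lam2 : ℂ) * ((starRingEnd ℂ) (phase L k r) * (f r : ℂ)) := by
    intro r; push_cast; ring
  have hS2 := hS1
  rw [Finset.sum_congr rfl fun r _ => hsplit r, Finset.sum_sub_distrib, Finset.sum_sub_distrib, ← Finset.mul_sum,
    hhop, hcont] at hS2
  have hdft : ∑ r : Tor L, (starRingEnd ℂ) (phase L k r) * (f r : ℂ) = dft L f k := rfl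
  rw [hdft] at hS2
  push_cast at hS2 ⊢
  linear_combination hS2

end Summit.HubbardSuperconductivity.HubbardSuperconductivity.Theorems.AnisotropyChord.Transfer.Fibre3

end
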